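import Literature.AlgebraicGeometry.HodgeTheory.CMHodgeGroupNoTwist
import HarnessLib

/-!
# Equidimensionality of the place projections of the derived algebra of an admissible `𝔤 ⊆ 𝔲_E(V,ψ)` for a CM
# field `E = ℚ[φ]`: if `[𝔤,𝔤]_ℂ` maps ONTO `𝔰𝔩(W_σ)` at one place, it does so at every place
# (Moonen–Zarhin 1999 §2 (2.3); Ribet 1983 §3; Deligne LNM 900 I §3)

Family `hodge`, layer `Literature/AlgebraicGeometry/HodgeTheory` (cell `pub-hodgeav-hg6`, req-37 (A) Q2b, TABLE X ROW 10 —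
`End⁰ = E` a quartic CM field, `dim_E H¹ = 3`, pattern `(3,0)+(2,1)` — brick (e) of the eng-5 g6 plan; continues
`CMHodgeGroupDerivedAlgebra`). UNCONDITIONAL; theorems only, no definition, no named fact, no `sorry`. HONEST FRAMING of
that cell: HC / HC_AV / HC_CM / H2 NOT proved — this file is linear algebra of polarized weight-one `ℚ`-Hodge structures
(it supplies the input `hproj` of `LieGoursatTwist.lift_or_twist_of_submodules` at a `Θ`-SCALAR place `σ` of a CM field
`E` with `dim_E H¹ = 3`, where no signature argument is available and an irreducible linear Lie algebra of a `3`-space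
could a priori be `𝔰𝔬₃`).

SETTING as in `CMDerived.*`: `H` effective polarized of weight `1`, `E = End_Hdg(V) = ℚ[φ]` of dimension `2|ι|` with
every non-zero element invertible, a CM type `μ : ι → ℂ` with blocks `W_k = ker(φ_ℂ − μ k)` of dimension `n₀` spanning
`V_ℂ` together with their conjugates, an admissible bracket-closed `𝔤` (commuting with `E`, `ψ`-skew) and its rational
derived span `𝔡 = span_ℚ {XX′ − X′X}`.
* `CMPlaces.finrank_ker_trace` — `dim 𝔰𝔩(M) = (dim M)² − 1`.
* **`CMPlaces.forall_proj_of_proj`** — EQUIDIMENSIONALITY: if every traceless endomorphism of ONE block `W_{μ k₁}` is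
  induced by an element of `(𝔡)_ℂ`, then the same holds at EVERY block `W_{μ k}`. PROOF (Galois-free, no classification):
  let `p_k = dim_ℂ {X|_{W_{μ k}} : X ∈ 𝔡_ℂ} ≤ n₀² − 1` (tracelessness, `CMDerived.trace_restrict_eq_zero`). With a
  non-zero skew `s ∈ E` and `|ι|` independent skew `y_i ∈ E` (`CMArith.exists_linearIndependent_skew`) the products
  `b_i = s y_i ∈ E` are `|ι|` independent `ψ`-SYMMETRIC elements, acting on `W_{μ k}` by scalars `τ_i(k)`; the rational
  space `S = Σ_i b_i 𝔡` consists of `φ`-commuting `ψ`-skew operators whose complexifications restrict into the same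
  spaces `{X|_{W_{μ k}}}` (the `b_i` are scalars there), so `dim_ℚ S = dim_ℂ S_ℂ ≤ Σ_k p_k` (an element of `S_ℂ` vanishing
  on every `W_{μ k}` is `0`, `CMThetaSocket.eq_zero_of_forall_eigenspace`). On the other hand, for rational
  `B_1, …, B_p ∈ 𝔡` with independent restrictions to `W_{μ k₁}` (`p = p_{k₁} = n₀² − 1`) the `|ι| p` products `b_i B_t`
  are `ℚ`-independent: a relation `Σ q_{it} b_i B_t = 0` restricted to `W_{μ k₁}` gives `Σ_i q_{it} τ_i(k₁) = 0`, i.e. the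
  element `Σ_i q_{it} b_i ∈ E` kills `W_{μ k₁} ≠ 0`, hence vanishes (`CMArith.apply_ne_zero`), hence `q_{it} = 0`. So
  `|ι| (n₀² − 1) ≤ Σ_k p_k ≤ p_k + (|ι| − 1)(n₀² − 1)`, forcing `p_k = n₀² − 1` for every `k`. («The simple factors of
  `Hg_ℂ^{der}` act on all the `W_σ` with the same image dimension because `[𝔤,𝔤]` is defined over `ℚ` and `E ⊗ ℂ`
  permutes nothing but scalars» — the rationality input of Moonen–Zarhin (2.3) / Ribet §3 made explicit.)

## References
* [MoonenZarhin1999LowDim] B. Moonen, Yu. Zarhin, Math. Ann. 315 (1999), §2 (2.3).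
* [Ribet1983] K. A. Ribet, Amer. J. Math. 105 (1983), §3 (the Lie algebra lemma and its use).
* [Deligne1982HodgeCycles] P. Deligne, LNM 900 (1982), I §3 (proof of Prop. 3.4: rational structures and base change).
* [Humphreys1972] J. E. Humphreys, GTM 9, §1.2 (`dim 𝔰𝔩(ℓ+1) = (ℓ+1)² − 1`).
-/

noncomputable section

open scoped TensorProduct
open Module

namespace Literature.AlgebraicGeometry.Motives

namespace HodgeStructure

universe u

variable {V : Type u} [AddCommGroup V] [Module ℚ V] {n : ℤ}

section General

variable {K : Type*} [Field K] {M : Type*} [AddCommGroup M] [Module K M] [FiniteDimensional K M]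

/-- **`dim 𝔰𝔩(M) = (dim M)² − 1`** for `M ≠ 0` (characteristic `0`): the trace is onto.
[cite: Humphreys1972, §1.2 (`A_ℓ`: `dim 𝔰𝔩(ℓ+1, F) = (ℓ+1)² - 1`)] -/
theorem CMPlaces.finrank_ker_trace [CharZero K] {d : ℕ} (hd : finrank K M = d) (hd0 : d ≠ 0) :
    finrank K (LinearMap.ker (LinearMap.trace K M)) = d ^ 2 - 1 := by
  have hsum := LinearMap.finrank_range_add_finrank_ker (LinearMap.trace K M)
  have hEnd : finrank K (M →ₗ[K] M) = d * d := by rw [Module.finrank_linearMap, hd]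
  have htop : LinearMap.range (LinearMap.trace K M) = ⊤ := by
    refine LinearMap.range_eq_top.2 fun c ↦ ⟨(c / d) • (1 : Module.End K M), ?_⟩
    rw [map_smul, LinearMap.trace_one, hd, smul_eq_mul, div_mul_cancel₀ c (Nat.cast_ne_zero.2 hd0)]
  rw [htop, finrank_top, Module.finrank_self, hEnd] at hsum
  rw [sq]
  omega

/-- **A subspace of `𝔰𝔩(M)` of dimension `≥ dim 𝔰𝔩(M)` is all of `𝔰𝔩(M)`** (stated over a plain type `M`, so that
the instance paths of `End(M)` stay short when `M` is a block of `V_ℂ`). [cite: Humphreys1972, §1.2] -/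
theorem CMPlaces.mem_of_le_ker_trace {R : Submodule K (Module.End K M)}
    (hR : R ≤ LinearMap.ker (LinearMap.trace K M))
    (hd : finrank K ↥(LinearMap.ker (LinearMap.trace K M)) ≤ finrank K ↥R)
    {Z : Module.End K M} (hZ : LinearMap.trace K M Z = 0) : Z ∈ R := by
  rw [Submodule.eq_of_le_of_finrank_le hR hd]
  exact LinearMap.mem_ker.2 hZ

end General

/-- Base change of a rational multiple: `(q • X)_ℂ = q • X_ℂ` with `q` read in `ℂ`. [folklore] -/
private theorem CMPlaces.baseChange_rat_smul (q : ℚ) (X : Module.End ℚ V) :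
    (q • X).baseChange ℂ = (q : ℂ) • X.baseChange ℂ := by
  rw [LinearMap.baseChange_smul]
  exact LinearMap.ext fun w => by
    rw [LinearMap.smul_apply, LinearMap.smul_apply, ← algebraMap_smul ℂ q (X.baseChange ℂ w), eq_ratCast]

/-- Base change of a rational linear combination. [folklore] -/
private theorem CMPlaces.baseChange_sum_smul {κ : Type*} (s : Finset κ) (g : κ → ℚ) (f : κ → Module.End ℚ V) :
    (∑ p ∈ s, g p • f p).baseChange ℂ = ∑ p ∈ s, (g p : ℂ) • (f p).baseChange ℂ := by
  classical
  induction s using Finset.induction_on with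
  | empty => rw [Finset.sum_empty, Finset.sum_empty, LinearMap.baseChange_zero]
  | insert p s hp ih =>
    rw [Finset.sum_insert hp, Finset.sum_insert hp, LinearMap.baseChange_add, ih, CMPlaces.baseChange_rat_smul]

/-- Base change of a finite sum of operators. [folklore] -/
private theorem CMPlaces.baseChange_sum {κ : Type*} (s : Finset κ) (f : κ → Module.End ℚ V) :
    (∑ p ∈ s, f p).baseChange ℂ = ∑ p ∈ s, (f p).baseChange ℂ := by
  classical
  induction s using Finset.induction_on with
  | empty => rw [Finset.sum_empty, Finset.sum_empty, LinearMap.baseChange_zero]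
  | insert p s hp ih => rw [Finset.sum_insert hp, Finset.sum_insert hp, LinearMap.baseChange_add, ih]

section Hodge

variable [Module.Finite ℚ V] [HodgeTensorFacts.{u, u}]

/-- **EQUIDIMENSIONALITY OF THE PLACE PROJECTIONS OF `[𝔤,𝔤]_ℂ`** (see the module docstring): in the setting above, if
every traceless endomorphism of the block `W_{μ k₁}` is induced by an element of the complex derived span `(𝔡)_ℂ`, then
for every place `k` every traceless endomorphism of `W_{μ k}` is induced by an element of `(𝔡)_ℂ`.
[cite: MoonenZarhin1999LowDim, §2 (2.3)] [cite: Ribet1983, §3] [cite: Deligne1982HodgeCycles, I §3 (proof of Prop. 3.4)] -/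
theorem CMPlaces.forall_proj_of_proj {ι : Type} [Fintype ι] [DecidableEq ι]
    (H : HodgeStructure V n) (hn : n = 1) (heff : H.IsEffective) (ψ : H.Polarization)
    {φ : Module.End ℚ V} (hφE : φ ∈ H.endAlg) {m : ℕ} (hE : ∀ a ∈ H.endAlg, ∃ q : Fin m → ℚ, a = ∑ k, q k • φ ^ (k : ℕ))
    (hEdim : Module.finrank ℚ H.endAlg = 2 * Fintype.card ι)
    (hdiv : ∀ a ∈ H.endAlg, a ≠ 0 → ∃ b : Module.End ℚ V, b * a = 1)
    (μ : ι → ℂ) (hinj : Function.Injective μ) (hdist : ∀ k k', μ k' ≠ starRingEnd ℂ (μ k)) {n₀ : ℕ} (hn₀ : n₀ ≠ 0)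
    (hrank : ∀ k, Module.finrank ℂ ↥(Module.End.eigenspace (φ.baseChange ℂ) (μ k) ⊓ H.piece 1 0) +
      Module.finrank ℂ ↥(Module.End.eigenspace (φ.baseChange ℂ) (μ k) ⊓ H.piece 0 1) = n₀)
    (htop : (⨆ kt : ι × Fin 2, Module.End.eigenspace (φ.baseChange ℂ)
      (if kt.2 = 0 then μ kt.1 else starRingEnd ℂ (μ kt.1))) = ⊤)
    (𝔤 : Submodule ℚ (Module.End ℚ V)) (hbr : ∀ X ∈ 𝔤, ∀ X' ∈ 𝔤, X * X' - X' * X ∈ 𝔤)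
    (hcomm : ∀ X ∈ 𝔤, ∀ a : H.endAlg, X * (a : Module.End ℚ V) = (a : Module.End ℚ V) * X)
    (hskew : ∀ X ∈ 𝔤, ∀ v w, ψ.form (X v) w + ψ.form v (X w) = 0)
    (k₁ : ι)
    (hproj₁ : ∀ Z : Module.End ℂ ↥(Module.End.eigenspace (φ.baseChange ℂ) (μ k₁)), LinearMap.trace ℂ _ Z = 0 →
      ∃ X ∈ spanC (Submodule.span ℚ {B | ∃ X ∈ 𝔤, ∃ X' ∈ 𝔤, X * X' - X' * X = B}),
        ∀ w : ↥(Module.End.eigenspace (φ.baseChange ℂ) (μ k₁)), X w = Z w)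
    (k : ι) (Z : Module.End ℂ ↥(Module.End.eigenspace (φ.baseChange ℂ) (μ k))) (hZ : LinearMap.trace ℂ _ Z = 0) :
    ∃ X ∈ spanC (Submodule.span ℚ {B | ∃ X ∈ 𝔤, ∃ X' ∈ 𝔤, X * X' - X' * X = B}),
      ∀ w : ↥(Module.End.eigenspace (φ.baseChange ℂ) (μ k)), X w = Z w := by
  classical
  -- notation and basic facts
  set 𝔡 := Submodule.span ℚ {B | ∃ X ∈ 𝔤, ∃ X' ∈ 𝔤, X * X' - X' * X = B} with h𝔡def
  let W : ι → Submodule ℂ (ℂ ⊗[ℚ] V) := fun i => Module.End.eigenspace (φ.baseChange ℂ) (μ i)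
  have hWdef : ∀ i, W i = Module.End.eigenspace (φ.baseChange ℂ) (μ i) := fun i => rfl
  have h𝔡𝔤 : 𝔡 ≤ 𝔤 := CMDerived.derived_le hbr
  have hEcomm : ∀ a ∈ H.endAlg, ∀ a' ∈ H.endAlg, a * a' = a' * a := fun a ha a' ha' =>
    CMThetaCentre.mul_comm_of_hE H hE ha ha'
  have hXW : ∀ X ∈ 𝔤, ∀ i, ∀ w ∈ W i, X.baseChange ℂ w ∈ W i := fun X hX i w hw =>
    UnitaryTheta.apply_mem_eigenspace_of_commute (UnitaryTheta.baseChange_commute H hφE hcomm hX) hw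
  have h𝔇φ : ∀ Y ∈ spanC 𝔡, Y * φ.baseChange ℂ = φ.baseChange ℂ * Y := fun Y hY =>
    UnitaryTheta.commute_of_mem_spanC H hφE (fun X hX a => hcomm X (h𝔡𝔤 hX) a) hY
  have hW𝔇 : ∀ Y ∈ spanC 𝔡, ∀ i, ∀ w ∈ W i, Y w ∈ W i := fun Y hY i w hw =>
    UnitaryTheta.apply_mem_eigenspace_of_commute (h𝔇φ Y hY) hw
  have hfin : ∀ i, Module.finrank ℂ ↥(W i) = n₀ := fun i => by
    rw [hWdef, CMTheta.finrank_eigenspace_eq_add H hn heff hφE, hrank i]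
  have hsl : ∀ i, Module.finrank ℂ ↥(LinearMap.ker (LinearMap.trace ℂ ↥(W i))) = n₀ ^ 2 - 1 := fun i =>
    CMPlaces.finrank_ker_trace (hfin i) hn₀
  have hWne : ∀ i, ∃ w ∈ W i, w ≠ 0 := fun i =>
    Submodule.exists_mem_ne_zero_of_ne_bot (fun h => hn₀ (by rw [← hfin i, h, finrank_bot]))
  -- the restriction maps `ρ i : 𝔡_ℂ → End(W i)`; their ranges lie in `𝔰𝔩(W i)`
  let ρ : ∀ i, ↥(spanC 𝔡) →ₗ[ℂ] Module.End ℂ ↥(W i) := fun i =>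
    { toFun := fun X => (X : Module.End ℂ (ℂ ⊗[ℚ] V)).restrict (hW𝔇 X X.2 i)
      map_add' := fun X Y => LinearMap.ext fun w => Subtype.ext (by
        simp only [Submodule.coe_add, LinearMap.add_apply, LinearMap.coe_restrict_apply])
      map_smul' := fun c X => LinearMap.ext fun w => Subtype.ext (by
        simp only [Submodule.coe_smul, LinearMap.smul_apply, LinearMap.coe_restrict_apply, RingHom.id_apply]) }
  have hρ : ∀ i (X : ↥(spanC 𝔡)) (w : ↥(W i)),
      ((ρ i X w : ↥(W i)) : ℂ ⊗[ℚ] V) = (X : Module.End ℂ (ℂ ⊗[ℚ] V)) (w : ℂ ⊗[ℚ] V) := fun _ _ _ => rfl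
  have hRsl : ∀ i, LinearMap.range (ρ i) ≤ LinearMap.ker (LinearMap.trace ℂ ↥(W i)) := by
    rintro i _ ⟨X, rfl⟩
    refine LinearMap.mem_ker.2 ?_
    show LinearMap.trace ℂ _ ((X : Module.End ℂ (ℂ ⊗[ℚ] V)).restrict (hW𝔇 X X.2 i)) = 0
    exact CMDerived.trace_restrict_eq_zero (fun Y hY => hXW Y hY i) X.2 (hW𝔇 X X.2 i)
  haveI : ∀ i, Module.Finite ℂ (Module.End ℂ ↥(W i)) := fun i => inferInstance
  haveI : ∀ i, Module.Free ℂ ↥(LinearMap.range (ρ i)) := fun i =>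
    letI : AddCommGroup ↥(LinearMap.range (ρ i)) := Module.addCommMonoidToAddCommGroup ℂ
    Module.Free.of_divisionRing ℂ _
  haveI : ∀ i, Module.Finite ℂ ↥(LinearMap.range (ρ i)) := fun i => inferInstance
  have hRle : ∀ i, Module.finrank ℂ ↥(LinearMap.range (ρ i)) ≤ n₀ ^ 2 - 1 := fun i => by
    have h := Submodule.finrank_mono (hRsl i)
    rwa [hsl i] at h
  -- it suffices to show `dim (range ρ k) ≥ n₀² − 1`
  suffices hk : n₀ ^ 2 - 1 ≤ Module.finrank ℂ ↥(LinearMap.range (ρ k)) by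
    have hle : Module.finrank ℂ ↥(LinearMap.ker (LinearMap.trace ℂ ↥(W k))) ≤
        Module.finrank ℂ ↥(LinearMap.range (ρ k)) := by rw [hsl k]; exact hk
    obtain ⟨X, hX⟩ : Z ∈ LinearMap.range (ρ k) := CMPlaces.mem_of_le_ker_trace (hRsl k) hle hZ
    exact ⟨X, X.2, fun w => by rw [← hρ k X w, hX]⟩
  -- `range ρ k₁ = 𝔰𝔩(W k₁)`
  have hR₁ : LinearMap.range (ρ k₁) = LinearMap.ker (LinearMap.trace ℂ ↥(W k₁)) := by
    refine le_antisymm (hRsl k₁) fun T hT => ?_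
    obtain ⟨X, hX, hXT⟩ := hproj₁ T (LinearMap.mem_ker.1 hT)
    exact ⟨⟨X, hX⟩, LinearMap.ext fun w => Subtype.ext (by rw [hρ, hXT w])⟩
  /- the symmetric elements `b i = s * y i` of `E` -/
  have hφadjE : ψ.adjoint φ ∈ H.endAlg := ψ.adjoint_mem_endAlg hφE
  have hφadj : ψ.adjoint φ ≠ φ := by
    intro h
    obtain ⟨w, hw, hw0⟩ := hWne k₁
    have h1 := CMNoTwist.adjoint_baseChange_apply H hn heff ψ hφE hE μ hinj hdist hn₀ hrank htop k₁ w hw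
    rw [h, Module.End.mem_eigenspace_iff.1 hw] at h1
    exact hdist k₁ k₁ (smul_left_injective ℂ hw0 h1)
  obtain ⟨s, hsdef⟩ : ∃ s : Module.End ℚ V, s = φ - ψ.adjoint φ := ⟨_, rfl⟩
  have hsE : s ∈ H.endAlg := by rw [hsdef]; exact sub_mem hφE hφadjE
  have hs0 : s ≠ 0 := by
    rw [hsdef]
    intro h
    exact hφadj (sub_eq_zero.1 h).symm
  have hsskew : ∀ v w, ψ.form (s v) w + ψ.form v (s w) = 0 := fun v w => by
    rw [hsdef, LinearMap.sub_apply, LinearMap.sub_apply, map_sub, LinearMap.sub_apply, map_sub,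
      ψ.form_apply_adjoint, ψ.isAdjointPair_adjoint_left φ v w]
    ring
  obtain ⟨y, hyli, hyE, hyskew⟩ := CMArith.exists_linearIndependent_skew H ψ hEcomm hdiv hEdim hsE hs0 hsskew
  obtain ⟨b, hbdef⟩ : ∃ b : Fin (Fintype.card ι) → Module.End ℚ V, ∀ i, b i = s * y i := ⟨_, fun _ => rfl⟩
  have hbE : ∀ i, b i ∈ H.endAlg := fun i => by rw [hbdef]; exact H.endAlg.mul_mem hsE (hyE i)
  have hbli : LinearIndependent ℚ b := by
    obtain ⟨sinv, hsinv⟩ := hdiv s hsE hs0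
    rw [Fintype.linearIndependent_iff]
    intro g hg
    have h2 : s * ∑ i, g i • y i = 0 := by
      rw [Finset.mul_sum]
      simpa only [mul_smul_comm, ← hbdef] using hg
    have h1 : ∑ i, g i • y i = 0 := by
      calc ∑ i, g i • y i = sinv * (s * ∑ i, g i • y i) := by rw [← mul_assoc, hsinv, one_mul]
        _ = 0 := by rw [h2, mul_zero]
    exact Fintype.linearIndependent_iff.1 hyli g h1
  have hbsym : ∀ i v w, ψ.form (b i v) w = ψ.form v (b i w) := fun i v w => by
    have h1 := hsskew (y i v) w
    have h2 := hyskew i v (s w)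
    have h3 : b i w = y i (s w) := by rw [hbdef, hEcomm _ hsE _ (hyE i), Module.End.mul_apply]
    rw [h3, hbdef, Module.End.mul_apply]
    linear_combination h1 - h2
  -- scalars of the `b i` on the blocks
  have hτex : ∀ i j, ∃ t : ℂ, ∀ w ∈ W j, (b i).baseChange ℂ w = t • w := fun i j =>
    CMTheta.exists_smul_of_mem_endAlg H hE (hbE i) (μ j)
  choose τ hτ using hτex
  /- the rational space `S = Σ_i b_i 𝔡` -/
  let L : (Fin (Fintype.card ι) → ↥𝔡) →ₗ[ℚ] Module.End ℚ V :=
    ∑ i, LinearMap.mulLeft ℚ (b i) ∘ₗ 𝔡.subtype ∘ₗ LinearMap.proj i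
  have hL : ∀ B, L B = ∑ i, b i * (B i : Module.End ℚ V) := fun B => by
    simp only [L, LinearMap.sum_apply, LinearMap.comp_apply, LinearMap.proj_apply, Submodule.subtype_apply,
      LinearMap.mulLeft_apply]
  let S : Submodule ℚ (Module.End ℚ V) := LinearMap.range L
  have hScomm : ∀ X ∈ S, ∀ a : H.endAlg, X * (a : Module.End ℚ V) = (a : Module.End ℚ V) * X := by
    rintro _ ⟨B, rfl⟩ a
    rw [hL, Finset.sum_mul, Finset.mul_sum]
    refine Finset.sum_congr rfl fun i _ => ?_
    rw [mul_assoc, hcomm _ (h𝔡𝔤 (B i).2) a, ← mul_assoc, hEcomm _ (hbE i) _ a.2, mul_assoc]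
  have hSskew : ∀ X ∈ S, ∀ v w, ψ.form (X v) w + ψ.form v (X w) = 0 := by
    rintro _ ⟨B, rfl⟩ v w
    rw [hL, LinearMap.sum_apply, LinearMap.sum_apply, map_sum, map_sum, LinearMap.sum_apply,
      ← Finset.sum_add_distrib]
    refine Finset.sum_eq_zero fun i _ => ?_
    have hBi : (B i : Module.End ℚ V) ∈ 𝔤 := h𝔡𝔤 (B i).2
    have e1 : ψ.form ((b i * (B i : Module.End ℚ V)) v) w = ψ.form ((B i : Module.End ℚ V) v) (b i w) := by
      rw [Module.End.mul_apply, hbsym]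
    have e2 : (b i * (B i : Module.End ℚ V)) w = (B i : Module.End ℚ V) (b i w) := by
      rw [show b i * (B i : Module.End ℚ V) = B i * b i from (hcomm _ hBi ⟨b i, hbE i⟩).symm, Module.End.mul_apply]
    rw [e1, e2]
    exact hskew _ hBi v (b i w)
  have hTφ : ∀ D ∈ spanC S, D * φ.baseChange ℂ = φ.baseChange ℂ * D := fun D hD =>
    UnitaryTheta.commute_of_mem_spanC H hφE hScomm hD
  have hWT : ∀ D ∈ spanC S, ∀ i, ∀ w ∈ W i, D w ∈ W i := fun D hD i w hw =>
    UnitaryTheta.apply_mem_eigenspace_of_commute (hTφ D hD) hw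
  have hTskew : ∀ D ∈ spanC S, ∀ x z, ψ.form.baseChange ℂ (D x) z + ψ.form.baseChange ℂ x (D z) = 0 :=
    fun D hD => ThetaSubalgebra.formBaseChange_add_eq_zero_of_mem_spanC ψ hSskew hD
  -- the restriction maps on `S_ℂ` land in `range ρ i`
  let σ : ∀ i, ↥(spanC S) →ₗ[ℂ] Module.End ℂ ↥(W i) := fun i =>
    { toFun := fun D => (D : Module.End ℂ (ℂ ⊗[ℚ] V)).restrict (hWT D D.2 i)
      map_add' := fun X Y => LinearMap.ext fun w => Subtype.ext (by
        simp only [Submodule.coe_add, LinearMap.add_apply, LinearMap.coe_restrict_apply])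
      map_smul' := fun c X => LinearMap.ext fun w => Subtype.ext (by
        simp only [Submodule.coe_smul, LinearMap.smul_apply, LinearMap.coe_restrict_apply, RingHom.id_apply]) }
  have hσ : ∀ i (D : ↥(spanC S)) (w : ↥(W i)),
      ((σ i D w : ↥(W i)) : ℂ ⊗[ℚ] V) = (D : Module.End ℂ (ℂ ⊗[ℚ] V)) (w : ℂ ⊗[ℚ] V) := fun _ _ _ => rfl
  have hσR : ∀ i (D : ↥(spanC S)), σ i D ∈ LinearMap.range (ρ i) := by
    intro i D
    -- span induction over `S_ℂ = span {X_ℂ : X ∈ S}`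
    suffices h : ∀ (D' : Module.End ℂ (ℂ ⊗[ℚ] V)) (hD' : D' ∈ spanC S),
        D'.restrict (hWT D' hD' i) ∈ LinearMap.range (ρ i) from h D D.2
    intro D' hD'
    induction hD' using Submodule.span_induction with
    | mem D₀ hD₀ =>
      obtain ⟨X, hXS, hXD⟩ := hD₀
      simp only at hXD
      subst hXD
      obtain ⟨B, rfl⟩ := hXS
      -- `X_ℂ|_{W i} = Σ_j τ j i • (B j)_ℂ|_{W i}`
      refine ⟨∑ j, τ j i • ⟨((B j : ↥𝔡) : Module.End ℚ V).baseChange ℂ, baseChange_mem_spanC (B j).2⟩, ?_⟩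
      refine LinearMap.ext fun w => Subtype.ext ?_
      rw [map_sum, LinearMap.sum_apply, Submodule.coe_sum, LinearMap.coe_restrict_apply, hL,
        CMPlaces.baseChange_sum, LinearMap.sum_apply]
      refine Finset.sum_congr rfl fun j _ => ?_
      rw [map_smul, LinearMap.smul_apply, Submodule.coe_smul, hρ, LinearMap.baseChange_mul, Module.End.mul_apply,
        hτ j i _ (hXW _ (h𝔡𝔤 (B j).2) i _ w.2)]
    | zero => exact ⟨0, LinearMap.ext fun w => Subtype.ext (by rw [map_zero]; rfl)⟩
    | add D₁ D₂ hD₁ hD₂ h₁ h₂ =>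
      obtain ⟨X₁, hX₁⟩ := h₁
      obtain ⟨X₂, hX₂⟩ := h₂
      refine ⟨X₁ + X₂, LinearMap.ext fun w => Subtype.ext ?_⟩
      have e₁ := congrArg (fun T : Module.End ℂ ↥(W i) => ((T w : ↥(W i)) : ℂ ⊗[ℚ] V)) hX₁
      have e₂ := congrArg (fun T : Module.End ℂ ↥(W i) => ((T w : ↥(W i)) : ℂ ⊗[ℚ] V)) hX₂
      simp only [LinearMap.coe_restrict_apply] at e₁ e₂
      rw [map_add, LinearMap.add_apply, Submodule.coe_add, e₁, e₂, LinearMap.coe_restrict_apply, LinearMap.add_apply]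
    | smul c D₁ hD₁ h₁ =>
      obtain ⟨X₁, hX₁⟩ := h₁
      refine ⟨c • X₁, LinearMap.ext fun w => Subtype.ext ?_⟩
      have e₁ := congrArg (fun T : Module.End ℂ ↥(W i) => ((T w : ↥(W i)) : ℂ ⊗[ℚ] V)) hX₁
      simp only [LinearMap.coe_restrict_apply] at e₁
      rw [map_smul, LinearMap.smul_apply, Submodule.coe_smul, e₁, LinearMap.coe_restrict_apply, LinearMap.smul_apply]
  -- the injection `S_ℂ ↪ Π i, range ρ i`: `dim_ℚ S ≤ Σ_i dim (range ρ i)`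
  let Φ : ↥(spanC S) →ₗ[ℂ] (∀ i, ↥(LinearMap.range (ρ i))) :=
    LinearMap.pi fun i => (σ i).codRestrict (LinearMap.range (ρ i)) (hσR i)
  have hΦinj : Function.Injective Φ := by
    intro D D' hDD'
    apply Subtype.ext
    have h0 : ((D : Module.End ℂ (ℂ ⊗[ℚ] V)) - D') = 0 := by
      refine CMThetaSocket.eq_zero_of_forall_eigenspace H hn heff ψ hφE hE μ hinj hdist htop
        (hTφ _ (Submodule.sub_mem _ D.2 D'.2)) (hTskew _ (Submodule.sub_mem _ D.2 D'.2)) fun i w hw => ?_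
      have h := congrArg (fun F => (((F i : ↥(LinearMap.range (ρ i))) : Module.End ℂ ↥(W i)) ⟨w, hw⟩ : ℂ ⊗[ℚ] V))
        hDD'
      simp only [Φ, LinearMap.pi_apply, LinearMap.codRestrict_apply] at h
      rw [hσ, hσ] at h
      rw [LinearMap.sub_apply, h, sub_self]
    exact sub_eq_zero.1 h0
  have hup : Module.finrank ℚ ↥S ≤ ∑ i, Module.finrank ℂ ↥(LinearMap.range (ρ i)) := by
    rw [← finrank_spanC_eq, ← Module.finrank_pi_fintype ℂ]
    exact LinearMap.finrank_le_finrank_of_injective hΦinj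
  /- lower bound: `|ι| (n₀² − 1) ≤ dim_ℚ S` -/
  let B𝔡 : Module.Basis (Fin (Module.finrank ℚ ↥𝔡)) ℚ ↥𝔡 := Module.finBasis ℚ ↥𝔡
  let v : Fin (Module.finrank ℚ ↥𝔡) → Module.End ℂ ↥(W k₁) := fun t =>
    ρ k₁ ⟨((B𝔡 t : ↥𝔡) : Module.End ℚ V).baseChange ℂ, baseChange_mem_spanC (B𝔡 t).2⟩
  have hvdef : ∀ t, v t = ρ k₁ ⟨((B𝔡 t : ↥𝔡) : Module.End ℚ V).baseChange ℂ, baseChange_mem_spanC (B𝔡 t).2⟩ :=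
    fun t => rfl
  have hvspan : LinearMap.range (ρ k₁) ≤ Submodule.span ℂ (Set.range v) := by
    rintro _ ⟨X, rfl⟩
    suffices h : ∀ (X' : Module.End ℂ (ℂ ⊗[ℚ] V)) (hX' : X' ∈ spanC 𝔡),
        ρ k₁ ⟨X', hX'⟩ ∈ Submodule.span ℂ (Set.range v) from h X X.2
    intro X' hX'
    induction hX' using Submodule.span_induction with
    | mem X₀ hX₀ =>
      obtain ⟨Y, hY, hYX⟩ := hX₀
      simp only at hYX
      subst hYX
      -- `Y = Σ_t q_t • B𝔡 t`, so `Y_ℂ = Σ_t q_t • (B𝔡 t)_ℂ`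
      have hYrepr : (Y : Module.End ℚ V) = ∑ t, (B𝔡.repr ⟨Y, hY⟩ t) • ((B𝔡 t : ↥𝔡) : Module.End ℚ V) := by
        have h := congrArg (fun Z : ↥𝔡 => (Z : Module.End ℚ V)) (B𝔡.sum_repr ⟨Y, hY⟩)
        simp only [Submodule.coe_sum, Submodule.coe_smul] at h
        exact h.symm
      have hmem : (⟨Y.baseChange ℂ, baseChange_mem_spanC hY⟩ : ↥(spanC 𝔡)) =
          ∑ t, ((B𝔡.repr ⟨Y, hY⟩ t : ℚ) : ℂ) • ⟨((B𝔡 t : ↥𝔡) : Module.End ℚ V).baseChange ℂ,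
            baseChange_mem_spanC (B𝔡 t).2⟩ := by
        refine Subtype.ext ?_
        rw [Submodule.coe_sum]
        simp only [Submodule.coe_smul]
        conv_lhs => rw [hYrepr]
        exact CMPlaces.baseChange_sum_smul _ _ _
      rw [hmem, map_sum]
      exact Submodule.sum_mem _ fun t _ => by
        rw [map_smul]
        exact Submodule.smul_mem _ _ (Submodule.subset_span ⟨t, rfl⟩)
    | zero =>
      have e : (⟨0, Submodule.zero_mem _⟩ : ↥(spanC 𝔡)) = 0 := rfl
      rw [e, map_zero]
      exact Submodule.zero_mem _
    | add X₁ X₂ hX₁ hX₂ h₁ h₂ =>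
      have e : (⟨X₁ + X₂, Submodule.add_mem _ hX₁ hX₂⟩ : ↥(spanC 𝔡)) = ⟨X₁, hX₁⟩ + ⟨X₂, hX₂⟩ := rfl
      rw [e, map_add]
      exact Submodule.add_mem _ h₁ h₂
    | smul c X₁ hX₁ h₁ =>
      have e : (⟨c • X₁, Submodule.smul_mem _ c hX₁⟩ : ↥(spanC 𝔡)) = c • ⟨X₁, hX₁⟩ := rfl
      rw [e, map_smul]
      exact Submodule.smul_mem _ c h₁
  -- an independent spanning subfamily `v ∘ a`, of size `≥ n₀² − 1`
  obtain ⟨κ, a, ha, hspan, hli⟩ := exists_linearIndependent' ℂ v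
  haveI : Finite κ := Finite.of_injective a ha
  letI : Fintype κ := Fintype.ofFinite κ
  have hcardκ : n₀ ^ 2 - 1 ≤ Fintype.card κ := by
    rw [← finrank_span_eq_card hli, hspan, ← hsl k₁, ← hR₁]
    exact Submodule.finrank_mono hvspan
  -- the family `(i, t) ↦ b i * B𝔡 (a t)` in `S`
  obtain ⟨f, hfdef⟩ : ∃ f : Fin (Fintype.card ι) × κ → Module.End ℚ V,
      ∀ p, f p = b p.1 * ((B𝔡 (a p.2) : ↥𝔡) : Module.End ℚ V) := ⟨_, fun _ => rfl⟩
  have hfS : ∀ p, f p ∈ S := fun p => by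
    refine ⟨fun i => if i = p.1 then B𝔡 (a p.2) else 0, ?_⟩
    rw [hfdef, hL, Finset.sum_eq_single p.1 (fun i _ hi => by rw [if_neg hi, Submodule.coe_zero, mul_zero])
      (fun h => absurd (Finset.mem_univ _) h), if_pos rfl]
  have hfli : LinearIndependent ℚ f := by
    rw [Fintype.linearIndependent_iff]
    intro g hg
    obtain ⟨w₁, hw₁, hw₁0⟩ := hWne k₁
    -- the complex coefficients `c t = Σ_i g (i,t) τ i k₁`
    obtain ⟨c, hcdef⟩ : ∃ c : κ → ℂ, ∀ t, c t = ∑ i, (g (i, t) : ℂ) * τ i k₁ := ⟨_, fun _ => rfl⟩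
    -- the relation restricted to `W k₁`
    have hrel : ∀ w ∈ W k₁, ∑ t, c t • ((B𝔡 (a t) : ↥𝔡) : Module.End ℚ V).baseChange ℂ w = 0 := by
      intro w hw
      have h := congrArg (fun X : Module.End ℚ V => X.baseChange ℂ w) hg
      rw [LinearMap.baseChange_zero, LinearMap.zero_apply, CMPlaces.baseChange_sum_smul, LinearMap.sum_apply,
        Fintype.sum_prod_type, Finset.sum_comm] at h
      rw [← h]
      refine Finset.sum_congr rfl fun t _ => ?_
      rw [hcdef, Finset.sum_smul]
      refine Finset.sum_congr rfl fun i _ => ?_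
      rw [LinearMap.smul_apply, hfdef, LinearMap.baseChange_mul, Module.End.mul_apply,
        hτ i k₁ _ (hXW _ (h𝔡𝔤 (B𝔡 (a t)).2) k₁ w hw), smul_smul]
    have hc : ∀ t, c t = 0 := by
      refine Fintype.linearIndependent_iff.1 hli c (LinearMap.ext fun w => Subtype.ext ?_)
      rw [LinearMap.sum_apply, Submodule.coe_sum, LinearMap.zero_apply, Submodule.coe_zero, ← hrel w w.2]
      refine Finset.sum_congr rfl fun t _ => ?_
      rw [Function.comp_apply, LinearMap.smul_apply, Submodule.coe_smul, hvdef, hρ]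
    -- each `Σ_i g (i,t) • b i ∈ E` kills `w₁ ≠ 0`, hence vanishes
    have hat : ∀ t, ∑ i, g (i, t) • b i = 0 := by
      intro t
      by_contra hne
      have hmem : ∑ i, g (i, t) • b i ∈ H.endAlg :=
        Subalgebra.sum_mem _ fun i _ => H.endAlg.smul_mem (hbE i) _
      refine CMArith.apply_ne_zero H hdiv hmem hne hw₁0 ?_
      rw [CMPlaces.baseChange_sum_smul, LinearMap.sum_apply]
      calc ∑ i, ((g (i, t) : ℂ) • (b i).baseChange ℂ) w₁ = ∑ i, ((g (i, t) : ℂ) * τ i k₁) • w₁ := by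
            refine Finset.sum_congr rfl fun i _ => ?_
            rw [LinearMap.smul_apply, hτ i k₁ w₁ hw₁, smul_smul]
        _ = c t • w₁ := by rw [hcdef, ← Finset.sum_smul]
        _ = 0 := by rw [hc t, zero_smul]
    -- independence of the `b i`
    intro p
    exact Fintype.linearIndependent_iff.1 hbli (fun i => g (i, p.2)) (hat p.2) p.1
  have hlow : Fintype.card ι * Fintype.card κ ≤ Module.finrank ℚ ↥S := by
    have hf' : LinearIndependent ℚ (fun p => (⟨f p, hfS p⟩ : ↥S)) := by
      refine LinearIndependent.of_comp S.subtype ?_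
      have e : (⇑S.subtype ∘ fun p => (⟨f p, hfS p⟩ : ↥S)) = f := rfl
      rw [e]
      exact hfli
    have h := hf'.fintype_card_le_finrank
    rwa [Fintype.card_prod, Fintype.card_fin] at h
  /- combine: `|ι| (n₀² − 1) ≤ dim S ≤ Σ_i dim (range ρ i) ≤ dim (range ρ k) + (|ι| − 1)(n₀² − 1)` -/
  have hsum : ∑ i, Module.finrank ℂ ↥(LinearMap.range (ρ i)) ≤
      Module.finrank ℂ ↥(LinearMap.range (ρ k)) + (Fintype.card ι - 1) * (n₀ ^ 2 - 1) := by
    rw [← Finset.add_sum_erase Finset.univ _ (Finset.mem_univ k)]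
    refine Nat.add_le_add_left ?_ _
    calc ∑ i ∈ Finset.univ.erase k, Module.finrank ℂ ↥(LinearMap.range (ρ i))
        ≤ ∑ i ∈ Finset.univ.erase k, (n₀ ^ 2 - 1) := Finset.sum_le_sum fun i _ => hRle i
      _ = (Fintype.card ι - 1) * (n₀ ^ 2 - 1) := by
        rw [Finset.sum_const, smul_eq_mul, Finset.card_erase_of_mem (Finset.mem_univ k), Finset.card_univ]
  have hι : 1 ≤ Fintype.card ι := Fintype.card_pos_iff.2 ⟨k⟩
  have key : Fintype.card ι * (n₀ ^ 2 - 1) ≤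
      Module.finrank ℂ ↥(LinearMap.range (ρ k)) + (Fintype.card ι - 1) * (n₀ ^ 2 - 1) :=
    ((Nat.mul_le_mul_left _ hcardκ).trans hlow).trans (hup.trans hsum)
  have hsplit : (Fintype.card ι - 1) * (n₀ ^ 2 - 1) + (n₀ ^ 2 - 1) = Fintype.card ι * (n₀ ^ 2 - 1) := by
    rw [Nat.sub_one_mul, Nat.sub_add_cancel (Nat.le_mul_of_pos_left _ hι)]
  omega

end Hodge

end HodgeStructure

end Literature.AlgebraicGeometry.Motives
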